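import Literature.Computability.Cryptography.ShorOrderFindingQuantum
import Literature.Computability.Cryptography.ShorOrdPost
import Literature.Computability.Complexity.StackLists
import Literature.Computability.Complexity.StackUnary
import Literature.Computability.Complexity.StackRoutines
import HarnessLib

/-!
# Shor's order-finding post-processor is polynomial time, I: the block tests

Family `PQC` (trunk `CryptoQuantFine`); first of the machines for the programming fact
`orderFindingPost_mem_FP` of `ShorOrderFindingQuantum.lean`, verified against the closed form
`OFPostCF.orderFindingPost_eq` (`OrderFindingPostSpec.lean`). The post-processor is the composite
of four `FP` stages (strings in, strings out, glued by `comp_mem_FP`):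

1. **this file** — `stageA1 : ⟨w, y⟩ ↦ ⟨N, ⟨1^ℓ, κ-bits⟩⟩`: the canonical numeral `N` of the
   modulus `n'` (`canonBits` of the second component of `w`), the instance length `ℓ = |w|` in
   unary, and for every trial `t < 4`, level `l < 2ℓ+1` and test type `σ` the bit
   `[2 · #{ones of y in block (t, l, σ)} ≤ B]` (Kitaev 1995, §3, before Lemma 9: "count how
   many 1's"; these two bits per level select the quadrant, `OFPostCF.levelNum`);
2. the integer refinement `A_t` (Kitaev's Lemma 10; `OFPostCF.refineNat`);
3. the continued-fraction candidates (Shor 1997, §5; `OFPostCF.cfCandidate`);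
4. their `lcm`.

Contents: the structured stack program `prog` (`StackPrograms.lean`; only unary counters and
bit tests, no arithmetic bank), its closed form `stageA1`, `runs_prog` and `stageA1_mem_FP`.

## References

* A. Yu. Kitaev, *Quantum measurements and the Abelian Stabilizer Problem*,
  arXiv:quant-ph/9511026 (1995), §3 (before Lemma 9; Lemma 10).
* P. W. Shor, SIAM J. Comput. 26 (1997) 1484–1509, §5.
* S. Arora, B. Barak, *Computational Complexity: A Modern Approach*, CUP 2009, §1.3.
-/

noncomputable section

namespace Literature.Computability.Cryptography

namespace OFPostA1

open _root_.Computability Complexity Complexity.Com Kitaev1995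

/-! ### The closed form -/

/-- The test bit of block `(t, l, σ)`: `[2 · #{ones} ≤ B]` over the window of `y` behind the
`ℓ` input bits. [cite: Kitaev1995, §3 (before Lemma 9)] -/
def testBit (ℓ : ℕ) (y : List Bool) (t l : ℕ) (σ : Bool) : Bool :=
  decide (2 * (((y.drop (ℓ + (t * (numLevels ℓ * (2 * blockSize ℓ)) + (l * (2 * blockSize ℓ) + σ.toNat * blockSize ℓ)))).take
    (blockSize ℓ)).count true) ≤ blockSize ℓ)

/-- The test bits of all blocks, in the order trial, level, cosine/sine. [folklore] -/
def kapBits (ℓ : ℕ) (y : List Bool) : List Bool :=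
  (List.range 4).flatMap fun t => (List.range (numLevels ℓ)).flatMap fun l =>
    [testBit ℓ y t l false, testBit ℓ y t l true]

/-- **Stage A1 of the post-processor**: `⟨w, y⟩ ↦ ⟨canonBits (n-numeral), ⟨1^{|w|}, kapBits⟩⟩`.
[folklore] -/
def stageA1 (z : List Bool) : List Bool :=
  boolPair (canonBits (boolUnpair (boolUnpair z).1).2)
    (boolPair (ones (boolUnpair z).1.length) (kapBits (boolUnpair z).1.length (boolUnpair z).2))

/-! ### Registers and register files -/

/-- The registers of the program. [folklore] -/
inductive K where
  | inp | A | T | M1 | P1 | W | A2 | T2 | M2 | P2 | N | L | LV | LC | BB | BC | Y | DUMP | U | T1 | Tx | OUT | RES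
  deriving DecidableEq, Fintype

/-- A register file given by an association list. [folklore] -/
def mk (l : List (K × List Bool)) : Regs K := fun r => (l.lookup r).getD []

/-- Writing into an association-list file prepends. [folklore] -/
theorem update_mk (l : List (K × List Bool)) (k : K) (v : List Bool) :
    Function.update (mk l) k v = mk ((k, v) :: l) := by
  funext r
  by_cases h : r = k
  · subst h; simp [mk, List.lookup]
  · rw [Function.update_of_ne h]
    have hb : (r == k) = false := beq_false_of_ne h
    simp [mk, List.lookup, hb]

/-- Reading the empty file. [folklore] -/
@[simp] theorem mk_nil (r : K) : mk [] r = [] := rfl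

/-- Reading past one entry. [folklore] -/
theorem mk_cons (k : K) (v : List Bool) (l : List (K × List Bool)) (r : K) :
    mk ((k, v) :: l) r = if r = k then v else mk l r := by
  by_cases h : r = k
  · subst h; simp [mk, List.lookup]
  · have hb : (r == k) = false := beq_false_of_ne h
    simp [mk, List.lookup, hb, h]

/-- The initial register file of the program. [folklore] -/
theorem init_eq (z : List Bool) : Regs.init K.inp z = mk [(K.inp, z)] := by
  funext r
  by_cases h : r = K.inp
  · subst h; rfl
  · have hb : (r == K.inp) = false := beq_false_of_ne h
    simp [Regs.init, h, mk, List.lookup, hb]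

/-! ### The program -/

/-- Append the leading `1` of the decoder to a numeral given *reversed* (most significant bit on
top): `canonBits`, on the reversed register. [folklore] -/
def canonC : Com K := pop .T2 (push .T2 true) (push .T2 false ;; push .T2 true) skip

/-- `BB := 1^{6144 · |LC|}` (the block size `B = 6144 (2ℓ+1)`). [folklore] -/
def mkBB : Com K := loop .LC (pushK .BB 6144) (pushK .BB 6144)

/-- The first half of the parser: unpair `⟨w, y⟩`, measure `ℓ = |w|`, unpair `w = ⟨x, n⟩`,
canonical numeral of `n`, `y` in reading order with the `ℓ` input bits skipped. [folklore] -/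
def parseA : Com K :=
  unpairW .inp .A .T .M1 .P1 ;;
  (copy .A .W .T1 .Tx ;; (addReg .W .L .T1 ;; (clear .W ;; (pour .A .W ;;
  (unpairW .W .A2 .T2 .M2 .P2 ;; (canonC ;; (pour .T2 .N ;;
  (pour .T .Y ;; (copy .L .LC .T1 .Tx ;; takeN .LC .Y .DUMP)))))))))

/-- The second half of the parser: the counters and the first two output components. [folklore] -/
def parseB : Com K :=
  addReg .L .LV .T1 ;; (addReg .L .LV .T1 ;; (push .LV true ;;
  (copy .LV .LC .T1 .Tx ;; (mkBB ;;
  (emit .N .OUT ;; (copy .L .LC .T1 .Tx ;; emit .LC .OUT))))))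

/-- **The parser.** [folklore] -/
def parse : Com K := parseA ;; parseB

/-- Count the ones of the next `|BC|` bits of `Y` into the unary counter `U`. [cite: Kitaev1995, §3 (before Lemma 9)] -/
def countC : Com K := loop .BC (pop .Y (push .U true) skip skip) (pop .Y (push .U true) skip skip)

/-- **One block test**: count `B` bits, double, subtract `B`, push `[2c ≤ B]` onto the output.
[cite: Kitaev1995, §3 (before Lemma 9)] -/
def blockC : Com K :=
  copy .BB .BC .T1 .Tx ;; (countC ;; (dblReg .U .T1 ;; (copy .BB .BC .T1 .Tx ;; (subFrom .U .BC ;;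
  pop .U (clear .U ;; push .OUT false) (clear .U ;; push .OUT false) (push .OUT true)))))

/-- One level: the cosine block, then the sine block. [folklore] -/
def levelC : Com K := blockC ;; blockC

/-- One trial: all levels. [folklore] -/
def trialC : Com K := copy .LV .LC .T1 .Tx ;; loop .LC levelC levelC

/-- **The whole program.** [folklore] -/
def prog : Com K := parse ;; (trialC ;; (trialC ;; (trialC ;; (trialC ;; pour .OUT .RES))))

/-! ### Simulation of the parser -/

/-- **`canonC` appends the decoder's leading `1`** to a numeral held reversed: from `T2 = lʳ` it
leaves `(canonBits l)ʳ`. [folklore] -/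
theorem runs_canonC (F : Regs K) (l : List Bool) (hT : F .T2 = l.reverse) :
    Runs canonC F (Function.update F .T2 (canonBits l).reverse) 4 := by
  rcases List.eq_nil_or_concat l with rfl | ⟨l', b, rfl⟩
  · have hT' : F .T2 = [] := by simpa using hT
    refine (Runs.pop_nil _ _ hT' (Runs.skip _)).of_eq ?_ (by omega)
    rw [canonBits_nil, List.reverse_nil, ← hT', Function.update_eq_self]
  · rw [List.concat_eq_append] at hT ⊢
    have hk : F .T2 = b :: l'.reverse := by rw [hT]; simp
    cases b
    · refine (Runs.pop_false _ _ hk ((Runs.push' rfl).seq (Runs.push' rfl))).of_eq ?_ (by omega)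
      rw [canonBits_append_false]
      simp [Function.update_idem]
    · refine (Runs.pop_true _ _ hk (Runs.push' rfl)).of_eq ?_ (by omega)
      rw [canonBits_append_true]
      simp [Function.update_idem, ← hk]

/-- **Simulation of `mkBB`**: `BB` gains `6144` units per bit of `LC`, `LC` is emptied. [folklore] -/
theorem runs_mkBB : ∀ (v : List Bool) (F : Regs K), F .LC = v →
    Runs mkBB F (Function.update (Function.update F .LC []) .BB (ones (6144 * v.length) ++ F .BB))
      (6146 * v.length + 1)
  | [], F, hF => by
    refine (Runs.loop_nil _ _ hF).of_eq ?_ (by simp)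
    funext i
    by_cases hi : i = .BB
    · subst hi; simp
    · rw [Function.update_of_ne hi]
      by_cases hj : i = .LC
      · subst hj; simp [hF]
      · rw [Function.update_of_ne hj]
  | b :: v, F, hF => by
    have h1 : ∀ b' : Bool, Runs (bif b' then pushK K.BB 6144 else pushK K.BB 6144) (Function.update F .LC v)
        (Function.update (Function.update F .LC v) .BB (ones 6144 ++ F .BB)) 6144 := by
      intro b'
      cases b' <;> simpa using runs_pushK K.BB 6144 (Function.update F .LC v)
    have h2 := runs_mkBB v (Function.update (Function.update F .LC v) .BB (ones 6144 ++ F .BB)) (by simp)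
    have hfin : Function.update (Function.update (Function.update (Function.update F K.LC v) K.BB
        (ones 6144 ++ F K.BB)) K.LC []) K.BB (ones (6144 * v.length) ++
          Function.update (Function.update F K.LC v) K.BB (ones 6144 ++ F K.BB) K.BB) =
        Function.update (Function.update F K.LC []) K.BB (ones (6144 * (b :: v).length) ++ F K.BB) := by
      funext i
      by_cases hi : i = .BB
      · subst hi
        simp only [Function.update_self, List.length_cons, ← List.append_assoc, ones_append, Nat.mul_succ]
      · rw [Function.update_of_ne hi, Function.update_of_ne hi]
        by_cases hj : i = .LC
        · subst hj; simp
        · simp [hi, hj]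
    rw [← hfin]
    cases b
    · exact (Runs.loop_false hF (h1 false) h2).of_eq rfl (by simp; ring_nf; omega)
    · exact (Runs.loop_true hF (h1 true) h2).of_eq rfl (by simp; ring_nf; omega)

/-- The instance. [folklore] -/
def qw (z : List Bool) : List Bool := (boolUnpair z).1
/-- The measured string. [folklore] -/
def qy (z : List Bool) : List Bool := (boolUnpair z).2
/-- The instance length `ℓ`. [folklore] -/
def ell (z : List Bool) : ℕ := (qw z).length
/-- The numeral of the modulus. [folklore] -/
def qn (z : List Bool) : List Bool := (boolUnpair (qw z)).2
/-- The numeral of the base. [folklore] -/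
def qx (z : List Bool) : List Bool := (boolUnpair (qw z)).1

/-! The successive register files of `parse` (association lists, newest writes first). -/

/-- Stage 0. [folklore] -/
def st0 (z : List Bool) : List (K × List Bool) := [(.inp, z)]
/-- Stage 1. [folklore] -/
def st1 (z : List Bool) : List (K × List Bool) :=
  (.P1, []) :: (.M1, flag (wellPaired z)) :: (.T, (qy z).reverse) :: (.A, (qw z).reverse) :: (.inp, []) :: st0 z
/-- Stage 2. [folklore] -/
def st2 (z : List Bool) : List (K × List Bool) := (.W, (qw z).reverse) :: st1 z
/-- Stage 3. [folklore] -/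
def st3 (z : List Bool) : List (K × List Bool) := (.L, ones (ell z)) :: (.W, ones (ell z)) :: st2 z
/-- Stage 4. [folklore] -/
def st4 (z : List Bool) : List (K × List Bool) := (.W, []) :: st3 z
/-- Stage 5. [folklore] -/
def st5 (z : List Bool) : List (K × List Bool) := (.W, qw z) :: (.A, []) :: st4 z
/-- Stage 6. [folklore] -/
def st6 (z : List Bool) : List (K × List Bool) :=
  (.P2, []) :: (.M2, flag (wellPaired (qw z))) :: (.T2, (qn z).reverse) :: (.A2, (qx z).reverse) :: (.W, []) :: st5 z
/-- Stage 7. [folklore] -/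
def st7 (z : List Bool) : List (K × List Bool) := (.T2, (canonBits (qn z)).reverse) :: st6 z
/-- Stage 8. [folklore] -/
def st8 (z : List Bool) : List (K × List Bool) := (.N, canonBits (qn z)) :: (.T2, []) :: st7 z
/-- Stage 9. [folklore] -/
def st9 (z : List Bool) : List (K × List Bool) := (.Y, qy z) :: (.T, []) :: st8 z
/-- Stage 10. [folklore] -/
def st10 (z : List Bool) : List (K × List Bool) := (.LC, ones (ell z)) :: st9 z
/-- Stage 11. [folklore] -/
def st11 (z : List Bool) : List (K × List Bool) :=
  (.DUMP, ((qy z).take (ell z)).reverse) :: (.Y, (qy z).drop (ell z)) :: (.LC, []) :: st10 z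
/-- Stage 12. [folklore] -/
def st12 (z : List Bool) : List (K × List Bool) := (.LV, ones (ell z)) :: (.L, ones (ell z)) :: st11 z
/-- Stage 13. [folklore] -/
def st13 (z : List Bool) : List (K × List Bool) := (.LV, ones (ell z + ell z)) :: (.L, ones (ell z)) :: st12 z
/-- Stage 14. [folklore] -/
def st14 (z : List Bool) : List (K × List Bool) := (.LV, ones (numLevels (ell z))) :: st13 z
/-- Stage 15. [folklore] -/
def st15 (z : List Bool) : List (K × List Bool) := (.LC, ones (numLevels (ell z))) :: st14 z
/-- Stage 16. [folklore] -/
def st16 (z : List Bool) : List (K × List Bool) := (.BB, ones (blockSize (ell z))) :: (.LC, []) :: st15 z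
/-- Stage 17. [folklore] -/
def st17 (z : List Bool) : List (K × List Bool) :=
  (.OUT, true :: false :: ((canonBits (qn z)).flatMap fun b => [b, b]).reverse) :: (.N, []) :: st16 z
/-- Stage 18. [folklore] -/
def st18 (z : List Bool) : List (K × List Bool) := (.LC, ones (ell z)) :: st17 z
/-- Stage 19. [folklore] -/
def st19 (z : List Bool) : List (K × List Bool) :=
  (.OUT, true :: false :: (((ones (ell z)).flatMap fun b => [b, b]).reverse ++
    (true :: false :: ((canonBits (qn z)).flatMap fun b => [b, b]).reverse))) :: (.LC, []) :: st18 z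

/-- The register file after `parse`. [folklore] -/
abbrev parsed (z : List Bool) : List (K × List Bool) := st19 z

attribute [local simp] st0 st1 st2 st3 st4 st5 st6 st7 st8 st9 st10 st11 st12 st13 st14 st15 st16 st17 st18 st19 update_mk mk_cons

/-- The cost of the parser. [folklore] -/
def parseCost (s : ℕ) : ℕ := 6146 * (2 * s + 1) + 130 * s + 120

/-- `canonBits` is not longer than the input plus one. [folklore] -/
theorem length_canonBits_le' (l : List Bool) : (canonBits l).length ≤ l.length + 1 := by
  unfold canonBits; split_ifs <;> simp

/-- Simulation of the first half of the parser. [folklore] -/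
theorem runs_parseA (z : List Bool) : Runs parseA (mk (st0 z)) (mk (st11 z)) (60 * z.length + 40) := by
  have hw : (qw z).length ≤ z.length := length_boolUnpair_fst_le z
  have hy : (qy z).length ≤ z.length := length_boolUnpair_snd_le z
  have hn : (qn z).length ≤ (qw z).length := length_boolUnpair_snd_le _
  have hcn := length_canonBits_le' (qn z)
  have hℓ : ell z = (qw z).length := rfl
  have h1 : Runs _ (mk (st0 z)) (mk (st1 z)) _ :=
    (runs_unpairW (k := K.inp) (a := .A) (t := .T) (M := .M1) (P := .P1) (by decide) (mk (st0 z)) rfl rfl).of_eq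
      (by simp [qw, qy]) le_rfl
  have h2 : Runs _ (mk (st1 z)) (mk (st2 z)) _ :=
    (runs_copy (a := K.A) (b := .W) (t := .T1) (u := .Tx) (by decide) (by decide) (by decide) (by decide) (by decide)
      (by decide) (mk (st1 z)) rfl rfl).of_eq (by simp) le_rfl
  have h3 : Runs _ (mk (st2 z)) (mk (st3 z)) _ :=
    (runs_addReg (p := K.W) (v := .L) (t := .T1) (by decide) (by decide) (by decide) (mk (st2 z)) rfl).of_eq
      (by simp [ell]) le_rfl
  have h4 : Runs _ (mk (st3 z)) (mk (st4 z)) _ := (runs_clear K.W (mk (st3 z))).of_eq (by simp) le_rfl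
  have h5 : Runs _ (mk (st4 z)) (mk (st5 z)) _ :=
    (runs_pour (a := K.A) (b := .W) (by decide) (mk (st4 z))).of_eq (by simp) le_rfl
  have h6 : Runs _ (mk (st5 z)) (mk (st6 z)) _ :=
    (runs_unpairW (k := K.W) (a := .A2) (t := .T2) (M := .M2) (P := .P2) (by decide) (mk (st5 z)) rfl rfl).of_eq
      (by simp [qn, qx]) le_rfl
  have h7 : Runs _ (mk (st6 z)) (mk (st7 z)) _ := (runs_canonC (mk (st6 z)) (qn z) (by simp)).of_eq (by simp) le_rfl
  have h8 : Runs _ (mk (st7 z)) (mk (st8 z)) _ :=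
    (runs_pour (a := K.T2) (b := .N) (by decide) (mk (st7 z))).of_eq (by simp) le_rfl
  have h9 : Runs _ (mk (st8 z)) (mk (st9 z)) _ :=
    (runs_pour (a := K.T) (b := .Y) (by decide) (mk (st8 z))).of_eq (by simp) le_rfl
  have h10 : Runs _ (mk (st9 z)) (mk (st10 z)) _ :=
    (runs_copy (a := K.L) (b := .LC) (t := .T1) (u := .Tx) (by decide) (by decide) (by decide) (by decide) (by decide)
      (by decide) (mk (st9 z)) rfl rfl).of_eq (by simp) le_rfl
  have h11 : Runs _ (mk (st10 z)) (mk (st11 z)) _ :=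
    (runs_takeN (q := K.LC) (s := .Y) (d := .DUMP) (by decide) (by decide) (by decide) _ (mk (st10 z)) rfl).of_eq
      (by simp [ell]) le_rfl
  refine (h1.seq (h2.seq (h3.seq (h4.seq (h5.seq (h6.seq (h7.seq (h8.seq (h9.seq (h10.seq h11)))))))))).of_eq rfl ?_
  simp [ell]
  omega

/-- Simulation of the second half of the parser. [folklore] -/
theorem runs_parseB (z : List Bool) : Runs parseB (mk (st11 z)) (mk (parsed z)) (6146 * (2 * z.length + 1) + 70 * z.length + 60) := by
  have hw : (qw z).length ≤ z.length := length_boolUnpair_fst_le z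
  have hn : (qn z).length ≤ (qw z).length := length_boolUnpair_snd_le _
  have hcn := length_canonBits_le' (qn z)
  have hℓ : ell z = (qw z).length := rfl
  have h12 : Runs _ (mk (st11 z)) (mk (st12 z)) _ :=
    (runs_addReg (p := K.L) (v := .LV) (t := .T1) (by decide) (by decide) (by decide) (mk (st11 z)) rfl).of_eq
      (by simp) le_rfl
  have h13 : Runs _ (mk (st12 z)) (mk (st13 z)) _ :=
    (runs_addReg (p := K.L) (v := .LV) (t := .T1) (by decide) (by decide) (by decide) (mk (st12 z)) rfl).of_eq
      (by simp) le_rfl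
  have h14 : Runs _ (mk (st13 z)) (mk (st14 z)) _ :=
    (Runs.push K.LV true (mk (st13 z))).of_eq (by simp [numLevels, ← ones_succ]; ring_nf) le_rfl
  have h15 : Runs _ (mk (st14 z)) (mk (st15 z)) _ :=
    (runs_copy (a := K.LV) (b := .LC) (t := .T1) (u := .Tx) (by decide) (by decide) (by decide) (by decide) (by decide)
      (by decide) (mk (st14 z)) rfl rfl).of_eq (by simp) le_rfl
  have h16 : Runs _ (mk (st15 z)) (mk (st16 z)) _ :=
    (runs_mkBB _ (mk (st15 z)) rfl).of_eq (by simp [blockSize]) le_rfl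
  have h17 : Runs _ (mk (st16 z)) (mk (st17 z)) _ :=
    (runs_emit (h := K.N) (o := .OUT) (by decide) (mk (st16 z))).of_eq (by simp) le_rfl
  have h18 : Runs _ (mk (st17 z)) (mk (st18 z)) _ :=
    (runs_copy (a := K.L) (b := .LC) (t := .T1) (u := .Tx) (by decide) (by decide) (by decide) (by decide) (by decide)
      (by decide) (mk (st17 z)) rfl rfl).of_eq (by simp) le_rfl
  have h19 : Runs _ (mk (st18 z)) (mk (st19 z)) _ :=
    (runs_emit (h := K.LC) (o := .OUT) (by decide) (mk (st18 z))).of_eq (by simp) le_rfl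
  refine (h12.seq (h13.seq (h14.seq (h15.seq (h16.seq (h17.seq (h18.seq h19))))))).of_eq rfl ?_
  simp [numLevels, ell]
  omega

/-- **Simulation of `parse`.** [folklore] -/
theorem runs_parse (z : List Bool) : Runs parse (mk (st0 z)) (mk (parsed z)) (parseCost z.length) :=
  ((runs_parseA z).seq (runs_parseB z)).of_eq rfl (by rw [parseCost]; omega)

/-! ### The kernel's register files -/

/-- The changing registers during the trials. [folklore] -/
structure KSt where
  /-- unread control bits -/
  Y : List Bool
  /-- unary counter of ones -/
  U : List Bool
  /-- bit counter -/
  BC : List Bool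
  /-- level counter -/
  LC : List Bool
  /-- output (reversed) -/
  OUT : List Bool

/-- The register file of a kernel state over the parsed file. [folklore] -/
def kfile (z : List Bool) (st : KSt) : Regs K
  | .Y => st.Y | .U => st.U | .BC => st.BC | .LC => st.LC | .OUT => st.OUT
  | .T1 => [] | .Tx => []
  | k => mk (parsed z) k

section KFile

variable (z : List Bool) (st : KSt) (v : List Bool)

/-- Reading `Y`. [folklore] -/ @[simp] theorem kfile_Y : kfile z st .Y = st.Y := rfl
/-- Reading `U`. [folklore] -/ @[simp] theorem kfile_U : kfile z st .U = st.U := rfl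
/-- Reading `BC`. [folklore] -/ @[simp] theorem kfile_BC : kfile z st .BC = st.BC := rfl
/-- Reading `LC`. [folklore] -/ @[simp] theorem kfile_LC : kfile z st .LC = st.LC := rfl
/-- Reading `OUT`. [folklore] -/ @[simp] theorem kfile_OUT : kfile z st .OUT = st.OUT := rfl
/-- Reading `T1`. [folklore] -/ @[simp] theorem kfile_T1 : kfile z st .T1 = [] := rfl
/-- Reading `Tx`. [folklore] -/ @[simp] theorem kfile_Tx : kfile z st .Tx = [] := rfl
/-- Reading `RES`. [folklore] -/ @[simp] theorem kfile_RES : kfile z st .RES = [] := by simp [kfile]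
/-- Reading `BB`. [folklore] -/ @[simp] theorem kfile_BB : kfile z st .BB = ones (blockSize (ell z)) := by simp [kfile]
/-- Reading `LV`. [folklore] -/ @[simp] theorem kfile_LV : kfile z st .LV = ones (numLevels (ell z)) := by simp [kfile]

/-- Writing `Y`. [folklore] -/
@[simp] theorem update_kfile_Y : Function.update (kfile z st) .Y v = kfile z { st with Y := v } := by
  funext k; cases k <;> simp [kfile]
/-- Writing `U`. [folklore] -/
@[simp] theorem update_kfile_U : Function.update (kfile z st) .U v = kfile z { st with U := v } := by
  funext k; cases k <;> simp [kfile]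
/-- Writing `BC`. [folklore] -/
@[simp] theorem update_kfile_BC : Function.update (kfile z st) .BC v = kfile z { st with BC := v } := by
  funext k; cases k <;> simp [kfile]
/-- Writing `LC`. [folklore] -/
@[simp] theorem update_kfile_LC : Function.update (kfile z st) .LC v = kfile z { st with LC := v } := by
  funext k; cases k <;> simp [kfile]
/-- Writing `OUT`. [folklore] -/
@[simp] theorem update_kfile_OUT : Function.update (kfile z st) .OUT v = kfile z { st with OUT := v } := by
  funext k; cases k <;> simp [kfile]

end KFile

/-- The parsed file is the kernel file of the initial state. [folklore] -/
theorem parsed_eq_kfile (z : List Bool) :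
    mk (parsed z) = kfile z ⟨(qy z).drop (ell z), [], [], [],
      true :: false :: (((ones (ell z)).flatMap fun b => [b, b]).reverse ++
        (true :: false :: ((canonBits (qn z)).flatMap fun b => [b, b]).reverse))⟩ := by
  funext k
  cases k <;> simp [kfile]

/-! ### Counting one block -/

/-- **Simulation of `countC`**: `|BC|` bits of `Y` are popped and their ones counted onto `U`
(an exhausted `Y` pops nothing). [cite: Kitaev1995, §3 (before Lemma 9)] -/
theorem runs_countC (z : List Bool) (ys U LC OUT : List Bool) (m : ℕ) :
    Runs countC (kfile z ⟨ys, U, ones m, LC, OUT⟩)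
      (kfile z ⟨ys.drop m, ones ((ys.take m).count true) ++ U, [], LC, OUT⟩) (5 * m + 1) := by
  have h := runs_indexLoop (c := K.BC) (body := pop K.Y (push K.U true) skip skip)
    (fun i => kfile z ⟨ys.drop i, ones ((ys.take i).count true) ++ U, [], LC, OUT⟩) 3 (fun i => rfl) (ones m) 0
    (fun i _ _ w => by
      rw [update_kfile_BC, update_kfile_BC]
      show Runs _ (kfile z ⟨ys.drop i, ones ((ys.take i).count true) ++ U, w, LC, OUT⟩)
        (kfile z ⟨ys.drop (i + 1), ones ((ys.take (i + 1)).count true) ++ U, w, LC, OUT⟩) 3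
      rcases hY : ys.drop i with _ | ⟨b, rest⟩
      · have hlen : ys.length ≤ i := List.drop_eq_nil_iff.1 hY
        have e1 : ys.drop (i + 1) = [] := List.drop_eq_nil_iff.2 (by omega)
        have e2 : ys.take (i + 1) = ys.take i := by
          rw [List.take_of_length_le (by omega), List.take_of_length_le hlen]
        rw [e1, e2]
        exact (Runs.pop_nil _ _ rfl (Runs.skip _)).of_eq rfl (by omega)
      · have hrest : ys.drop (i + 1) = rest := by
          rw [← List.drop_drop, hY]; rfl
        have hi : ys[i]? = some b := by
          rw [← Nat.add_zero i, ← List.getElem?_drop, hY]; rfl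
        have htake : ys.take (i + 1) = ys.take i ++ [b] := by
          rw [List.take_add_one, hi]; rfl
        rw [hrest, htake, List.count_append]
        cases b
        · have hR : Runs (pop K.Y (push K.U true) skip skip)
              (kfile z ⟨false :: rest, ones ((ys.take i).count true) ++ U, w, LC, OUT⟩)
              (Function.update (kfile z ⟨false :: rest, ones ((ys.take i).count true) ++ U, w, LC, OUT⟩) .Y rest) (0 + 2) :=
            Runs.pop_false _ _ (k := K.Y) (w := rest) rfl (Runs.skip _)
          refine hR.of_eq ?_ (by omega)
          rw [update_kfile_Y]
          simp
        · have hR : Runs (pop K.Y (push K.U true) skip skip)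
              (kfile z ⟨true :: rest, ones ((ys.take i).count true) ++ U, w, LC, OUT⟩)
              (Function.update (Function.update (kfile z ⟨true :: rest, ones ((ys.take i).count true) ++ U, w, LC, OUT⟩) .Y rest)
                .U (true :: Function.update (kfile z ⟨true :: rest, ones ((ys.take i).count true) ++ U, w, LC, OUT⟩) .Y rest .U)) (1 + 2) :=
            Runs.pop_true _ _ (k := K.Y) (w := rest) rfl (Runs.push' rfl)
          refine hR.of_eq ?_ (by omega)
          rw [update_kfile_Y, kfile_U, update_kfile_U]
          simp [ones, List.replicate_add])
  have hstart : Function.update (kfile z ⟨ys.drop 0, ones ((ys.take 0).count true) ++ U, [], LC, OUT⟩) .BC (ones m) =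
      kfile z ⟨ys, U, ones m, LC, OUT⟩ := by
    rw [update_kfile_BC]; rfl
  rw [hstart] at h
  exact h.of_eq (by simp) (by simp)

/-! ### One block, one level, one trial -/

/-- The test bit of the next block of a stream: `[2 · #{ones among the next B bits} ≤ B]`.
[cite: Kitaev1995, §3 (before Lemma 9)] -/
def tbit (B : ℕ) (S : List Bool) : Bool := decide (2 * (S.take B).count true ≤ B)

/-- The cost of one block test. [folklore] -/
def blockCost (B : ℕ) : ℕ := 41 * B + 20

/-- **Simulation of `blockC`**: the next `B` bits are consumed and their test bit pushed.
[cite: Kitaev1995, §3 (before Lemma 9)] -/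
theorem runs_blockC (z : List Bool) (ys LC OUT : List Bool) :
    Runs blockC (kfile z ⟨ys, [], [], LC, OUT⟩)
      (kfile z ⟨ys.drop (blockSize (ell z)), [], [], LC, tbit (blockSize (ell z)) ys :: OUT⟩) (blockCost (blockSize (ell z))) := by
  set B := blockSize (ell z) with hB
  set c := (ys.take B).count true with hc
  have hcB : c ≤ B := by
    rw [hc]; exact (List.count_le_length).trans (List.length_take_le _ _)
  have h1 : Runs (copy K.BB .BC .T1 .Tx) (kfile z ⟨ys, [], [], LC, OUT⟩) (kfile z ⟨ys, [], ones B, LC, OUT⟩) (10 * B + 3) := by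
    refine (runs_copy (a := K.BB) (b := K.BC) (t := .T1) (u := .Tx) (by decide) (by decide) (by decide) (by decide)
      (by decide) (by decide) _ rfl rfl).of_eq ?_ (by simp [hB])
    rw [update_kfile_BC]; simp [hB]
  have h2 := runs_countC z ys [] LC OUT B
  simp only [List.append_nil, ← hc] at h2
  have h3 : Runs (dblReg K.U .T1) (kfile z ⟨ys.drop B, ones c, [], LC, OUT⟩) (kfile z ⟨ys.drop B, ones (2 * c), [], LC, OUT⟩) (10 * c + 2) := by
    refine (runs_dblReg (p := K.U) (t := .T1) (by decide) _ rfl).of_eq ?_ (by simp)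
    rw [update_kfile_U]; simp
  have h4 : Runs (copy K.BB .BC .T1 .Tx) (kfile z ⟨ys.drop B, ones (2 * c), [], LC, OUT⟩)
      (kfile z ⟨ys.drop B, ones (2 * c), ones B, LC, OUT⟩) (10 * B + 3) := by
    refine (runs_copy (a := K.BB) (b := K.BC) (t := .T1) (u := .Tx) (by decide) (by decide) (by decide) (by decide)
      (by decide) (by decide) _ rfl rfl).of_eq ?_ (by simp [hB])
    rw [update_kfile_BC]; simp [hB]
  have h5 : Runs (subFrom K.U .BC) (kfile z ⟨ys.drop B, ones (2 * c), ones B, LC, OUT⟩)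
      (kfile z ⟨ys.drop B, ones (2 * c - B), [], LC, OUT⟩) (4 * B + 1) := by
    refine (runs_subFrom (x := K.U) (y := K.BC) (by decide) _ _ rfl).of_eq ?_ (by simp)
    rw [update_kfile_BC, kfile_U, update_kfile_U]
    simp [ones, List.drop_replicate]
  have h6 : Runs (pop K.U (clear .U ;; push .OUT false) (clear .U ;; push .OUT false) (push .OUT true))
      (kfile z ⟨ys.drop B, ones (2 * c - B), [], LC, OUT⟩) (kfile z ⟨ys.drop B, [], [], LC, tbit B ys :: OUT⟩) (2 * B + 4) := by
    by_cases hle : 2 * c ≤ B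
    · have h0 : 2 * c - B = 0 := by omega
      rw [h0]
      refine (Runs.pop_nil _ _ rfl (Runs.push' (k := K.OUT) (b := true) rfl)).of_eq ?_ (by omega)
      rw [kfile_OUT, update_kfile_OUT, tbit, ← hc, decide_eq_true hle]
      rfl
    · set d := 2 * c - B - 1 with hdd
      have hd : 2 * c - B = d + 1 := by omega
      rw [hd, ones_succ]
      have hcl : Runs (clear K.U) (kfile z ⟨ys.drop B, ones d, [], LC, OUT⟩) (kfile z ⟨ys.drop B, [], [], LC, OUT⟩) (2 * d + 1) :=
        (runs_clear K.U _).of_eq (by rw [update_kfile_U]) (by simp)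
      have hpu : Runs (push K.OUT false) (kfile z ⟨ys.drop B, [], [], LC, OUT⟩) (kfile z ⟨ys.drop B, [], [], LC, false :: OUT⟩) 1 :=
        Runs.push' (by rw [update_kfile_OUT]; rfl)
      have hmid : Runs (clear K.U ;; push K.OUT false)
          (Function.update (kfile z ⟨ys.drop B, true :: ones d, [], LC, OUT⟩) .U (ones d))
          (kfile z ⟨ys.drop B, [], [], LC, false :: OUT⟩) (2 * d + 1 + 1) := by
        rw [update_kfile_U]; exact hcl.seq hpu
      have hR : Runs (pop K.U (clear .U ;; push .OUT false) (clear .U ;; push .OUT false) (push .OUT true))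
          (kfile z ⟨ys.drop B, true :: ones d, [], LC, OUT⟩) (kfile z ⟨ys.drop B, [], [], LC, false :: OUT⟩) (2 * d + 1 + 1 + 2) :=
        Runs.pop_true _ _ (k := K.U) (w := ones d) rfl hmid
      refine hR.of_eq ?_ (by omega)
      rw [tbit, ← hc, decide_eq_false hle]
  refine (h1.seq (h2.seq (h3.seq (h4.seq (h5.seq h6))))).of_eq rfl ?_
  rw [blockCost]; omega

/-- The test bits of `k` levels of a stream, in the order they are pushed. [folklore] -/
def lvBits (B k : ℕ) (ys : List Bool) : List Bool :=
  (List.range k).flatMap fun l => [tbit B (ys.drop (l * (2 * B))), tbit B (ys.drop (l * (2 * B) + B))]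

/-- One more level. [folklore] -/
theorem lvBits_succ (B k : ℕ) (ys : List Bool) :
    lvBits B (k + 1) ys = lvBits B k ys ++ [tbit B (ys.drop (k * (2 * B))), tbit B (ys.drop (k * (2 * B) + B))] := by
  simp [lvBits, List.range_succ, List.flatMap_append]

/-- The cost of one level. [folklore] -/
def levelCost (B : ℕ) : ℕ := 2 * blockCost B

/-- **Simulation of `levelC`**: two blocks. [folklore] -/
theorem runs_levelC (z : List Bool) (ys LC OUT : List Bool) :
    Runs levelC (kfile z ⟨ys, [], [], LC, OUT⟩)
      (kfile z ⟨ys.drop (2 * blockSize (ell z)), [], [], LC,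
        tbit (blockSize (ell z)) (ys.drop (blockSize (ell z))) :: tbit (blockSize (ell z)) ys :: OUT⟩)
      (levelCost (blockSize (ell z))) := by
  refine ((runs_blockC z ys LC OUT).seq (runs_blockC z _ LC _)).of_eq ?_ (by rw [levelCost]; omega)
  rw [List.drop_drop, two_mul]

/-- **Simulation of the level loop**: `|LC|` levels. [folklore] -/
theorem runs_levelLoop (z : List Bool) (ys OUT : List Bool) (L : ℕ) :
    Runs (loop K.LC levelC levelC) (kfile z ⟨ys, [], [], ones L, OUT⟩)
      (kfile z ⟨ys.drop (L * (2 * blockSize (ell z))), [], [], [], (lvBits (blockSize (ell z)) L ys).reverse ++ OUT⟩)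
      ((levelCost (blockSize (ell z)) + 2) * L + 1) := by
  set B := blockSize (ell z) with hB
  have h := runs_indexLoop (c := K.LC) (body := levelC)
    (fun k => kfile z ⟨ys.drop (k * (2 * B)), [], [], [], (lvBits B k ys).reverse ++ OUT⟩) (levelCost B) (fun k => rfl) (ones L) 0
    (fun k _ _ w => by
      rw [update_kfile_LC, update_kfile_LC]
      show Runs _ (kfile z ⟨ys.drop (k * (2 * B)), [], [], w, (lvBits B k ys).reverse ++ OUT⟩)
        (kfile z ⟨ys.drop ((k + 1) * (2 * B)), [], [], w, (lvBits B (k + 1) ys).reverse ++ OUT⟩) (levelCost B)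
      refine (runs_levelC z _ w _).of_eq ?_ le_rfl
      rw [List.drop_drop, List.drop_drop, show k * (2 * B) + 2 * B = (k + 1) * (2 * B) by ring, lvBits_succ,
        List.reverse_append]
      simp [hB])
  have hstart : Function.update (kfile z ⟨ys.drop (0 * (2 * B)), [], [], [], (lvBits B 0 ys).reverse ++ OUT⟩) .LC (ones L) =
      kfile z ⟨ys, [], [], ones L, OUT⟩ := by
    rw [update_kfile_LC]; simp [lvBits]
  rw [hstart] at h
  exact h.of_eq (by simp) (by simp)

/-- The cost of one trial. [folklore] -/
def trialCost (B L : ℕ) : ℕ := (levelCost B + 2) * L + 1 + (10 * L + 3)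

/-- **Simulation of `trialC`**: all levels of one trial. [folklore] -/
theorem runs_trialC (z : List Bool) (ys OUT : List Bool) :
    Runs trialC (kfile z ⟨ys, [], [], [], OUT⟩)
      (kfile z ⟨ys.drop (numLevels (ell z) * (2 * blockSize (ell z))), [], [], [],
        (lvBits (blockSize (ell z)) (numLevels (ell z)) ys).reverse ++ OUT⟩)
      (trialCost (blockSize (ell z)) (numLevels (ell z))) := by
  have h1 : Runs (copy K.LV .LC .T1 .Tx) (kfile z ⟨ys, [], [], [], OUT⟩) (kfile z ⟨ys, [], [], ones (numLevels (ell z)), OUT⟩)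
      (10 * numLevels (ell z) + 3) := by
    refine (runs_copy (a := K.LV) (b := K.LC) (t := .T1) (u := .Tx) (by decide) (by decide) (by decide) (by decide)
      (by decide) (by decide) _ rfl rfl).of_eq ?_ (by simp)
    rw [update_kfile_LC]; simp
  exact (h1.seq (runs_levelLoop z ys OUT _)).of_eq rfl (by rw [trialCost]; omega)

/-! ### The whole program -/

/-- `ℓ ≤ |z|`. [folklore] -/
theorem ell_le (z : List Bool) : ell z ≤ z.length := length_boolUnpair_fst_le z

/-- The cost of the whole program in terms of the input length. [folklore] -/
def progCost (s : ℕ) : ℕ :=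
  parseCost s + 4 * trialCost (6144 * (2 * s + 1)) (2 * s + 1) + (70 * s + 60)

/-- `trialCost` is monotone. [folklore] -/
theorem trialCost_mono {B B' L L' : ℕ} (hB : B ≤ B') (hL : L ≤ L') : trialCost B L ≤ trialCost B' L' := by
  unfold trialCost levelCost blockCost
  have : (2 * (41 * B + 20) + 2) * L ≤ (2 * (41 * B' + 20) + 2) * L' := Nat.mul_le_mul (by omega) hL
  omega

/-- The test bits of the four trials of the stream (behind the `ℓ` input bits). [folklore] -/
theorem kapBits_eq (ℓ : ℕ) (y : List Bool) :
    kapBits ℓ y = (List.range 4).flatMap fun t => lvBits (blockSize ℓ) (numLevels ℓ)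
      ((y.drop ℓ).drop (t * (numLevels ℓ * (2 * blockSize ℓ)))) := by
  simp only [kapBits, lvBits, List.drop_drop]
  refine congrArg (fun g => List.flatMap g (List.range 4)) (funext fun t => ?_)
  refine congrArg (fun g => List.flatMap g (List.range (numLevels ℓ))) (funext fun l => ?_)
  simp only [testBit, tbit, Bool.toNat_false, Bool.toNat_true, zero_mul, one_mul, add_zero, Nat.add_assoc]

/-- Each trial contributes `2L` bits. [folklore] -/
theorem length_lvBits (B : ℕ) (S : List Bool) : ∀ k, (lvBits B k S).length = 2 * k
  | 0 => by simp [lvBits]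
  | k + 1 => by rw [lvBits_succ, List.length_append, length_lvBits B S k]; simp; ring

/-- **Simulation of the whole program**: on every input `z` it leaves `stageA1 z` in `RES` within
`progCost |z|` steps. [folklore] -/
theorem runs_prog (z : List Bool) :
    ∃ Rf : Regs K, Runs prog (Regs.init K.inp z) Rf (progCost z.length) ∧ Rf .RES = stageA1 z := by
  rw [init_eq]
  set B := blockSize (ell z) with hB
  set L := numLevels (ell z) with hL
  set X := L * (2 * B) with hX
  set ys := (qy z).drop (ell z) with hys
  set OUT0 := true :: false :: (((ones (ell z)).flatMap fun b => [b, b]).reverse ++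
    (true :: false :: ((canonBits (qn z)).flatMap fun b => [b, b]).reverse)) with hOUT0
  have hp := runs_parse z
  rw [parsed_eq_kfile] at hp
  have t1 := runs_trialC z ys OUT0
  have t2 := runs_trialC z (ys.drop X) ((lvBits B L ys).reverse ++ OUT0)
  have t3 := runs_trialC z ((ys.drop X).drop X) ((lvBits B L (ys.drop X)).reverse ++ ((lvBits B L ys).reverse ++ OUT0))
  have t4 := runs_trialC z (((ys.drop X).drop X).drop X)
    ((lvBits B L ((ys.drop X).drop X)).reverse ++ ((lvBits B L (ys.drop X)).reverse ++ ((lvBits B L ys).reverse ++ OUT0)))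
  set F4 := kfile z ⟨(((ys.drop X).drop X).drop X).drop X, [], [], [],
    (lvBits B L (((ys.drop X).drop X).drop X)).reverse ++ ((lvBits B L ((ys.drop X).drop X)).reverse ++
      ((lvBits B L (ys.drop X)).reverse ++ ((lvBits B L ys).reverse ++ OUT0)))⟩ with hF4
  have h5 := runs_pour (a := K.OUT) (b := K.RES) (by decide) F4
  have hOUTlen : (F4 .OUT).length ≤ 20 * ell z + 14 := by
    have hc := length_canonBits_le' (qn z)
    have hqn : (qn z).length ≤ ell z := length_boolUnpair_snd_le _
    have hdbl : ∀ l : List Bool, (l.flatMap fun b => [b, b]).length = 2 * l.length := fun l => by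
      induction l with
      | nil => rfl
      | cons b l ih => simp [List.flatMap_cons, ih]; ring
    rw [hF4, kfile_OUT]
    simp only [List.length_append, List.length_reverse, length_lvBits, hOUT0, List.length_cons, hdbl,
      List.length_replicate]
    rw [hL, numLevels]
    omega
  refine ⟨_, (hp.seq (t1.seq (t2.seq (t3.seq (t4.seq h5))))).of_eq rfl ?_, ?_⟩
  · -- cost
    have hℓ := ell_le z
    have ht : trialCost (blockSize (ell z)) (numLevels (ell z)) ≤ trialCost (6144 * (2 * z.length + 1)) (2 * z.length + 1) := by
      refine trialCost_mono ?_ ?_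
      · rw [blockSize, numLevels]; exact Nat.mul_le_mul_left _ (by omega)
      · rw [numLevels]; omega
    rw [progCost]
    omega
  · -- the output
    rw [Function.update_self, hF4, kfile_OUT, kfile_RES, List.append_nil]
    simp only [List.reverse_append, List.reverse_reverse, hOUT0, List.reverse_cons, List.append_assoc,
      List.cons_append, List.nil_append]
    rw [stageA1, boolPair, boolPair, kapBits_eq]
    simp only [List.range_succ, List.range_zero, List.nil_append, List.flatMap_cons,
      List.flatMap_nil, List.append_nil, List.drop_drop, zero_mul, List.append_assoc, List.cons_append,
      hys, hX, hB, hL, ell, qy, qn, qw, add_zero, one_mul, Nat.add_assoc,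
      show ∀ n : ℕ, 2 * n = n + n from fun n => two_mul n, show ∀ n : ℕ, 3 * n = n + (n + n) from fun n => by ring]

/-- The step-bound polynomial of the program. [folklore] -/
def costPoly : Polynomial ℕ :=
  let X : Polynomial ℕ := Polynomial.X
  let B := 6144 * (2 * X + 1)
  let L := 2 * X + 1
  (6146 * (2 * X + 1) + 130 * X + 120) + 4 * ((2 * (41 * B + 20) + 2) * L + 1 + (10 * L + 3)) + (70 * X + 60)

/-- The step-bound polynomial evaluates to the step bound. [folklore] -/
theorem costPoly_eval (s : ℕ) : costPoly.eval s = progCost s := by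
  simp [costPoly, progCost, parseCost, trialCost, levelCost, blockCost]

/-- **Stage A1 is polynomial time: `stageA1 ∈ FP`** (`Com.mem_FP`, `StackPrograms.lean`).
[cite: AroraBarak2009, §1.3 (polynomial time on Turing machines; robustness)] -/
theorem stageA1_mem_FP : stageA1 ∈ FP :=
  Com.mem_FP prog K.inp K.RES costPoly stageA1 fun z => by
    obtain ⟨Rf, h, hout⟩ := runs_prog z
    exact ⟨Rf, Or.inl (by rw [costPoly_eval]; exact h), hout⟩

end OFPostA1

end Literature.Computability.Cryptography

end
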